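import Literature.NumberTheory.Automorphic.UnitaryGroupLocalFactors
import Mathlib.FieldTheory.Galois.Basic
import HarnessLib

/-!
# The local unitary group at a split place: `U(J)(F_v) ≃ GL_N(E_w)`
(Mok, *Endoscopic classification of representations of quasi-split unitary groups* (2015), §1 Notation;
Platonov–Rapinchuk, *Algebraic Groups and Number Theory* (1994), §5.1;
Cassels–Fröhlich, *Algebraic Number Theory* (1967), Ch. II §§10–11, Ch. VII §1.1)

Topic `NumberTheory/Automorphic`; namespace `Literature.NumberTheory.Automorphic` (grouping sub-namespaces
`GLn`, `UnitaryGroup`). Definitions and proved lemmas only: **no named facts, 0 proof holes**.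

**Setting** — that of `UnitaryGroupAutomorphicRep` / `UnitaryGroupLocalFactors`: `E/F` number fields,
`c : E ≃ₐ[F] E`, `N : ℕ`, `J ∈ M_N(E)`, and a finite place `v` of `F`. Those files construct the local group
`U(J)(F_v) ≤ GL_N(E ⊗_F F_v) = GL_N(Π_{w ∣ v} E_w)` (`UnitaryGroup.«local»`, and its factor form
`UnitaryGroup.localPi … v ≤ Π_{w ∣ v} GL_N(E_w)` with the fibrewise criterion `mem_localPi_iff`) and assert in
their docstrings, without proof, the standard fact that **at a place `v` of `F` that splits in the quadratic
extension `E`, `U(J)(F_v)` projects isomorphically onto either factor `GL_N(E_w)`** (Mok, §1: "for `v` split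
`U(N)(F_v) ≅ GL_N(F_v)`"). This file PROVES it:

* §1 quadratic Galois bookkeeping: for `[Algebra.IsQuadraticExtension F E]` and `c ≠ 1`, every
  `σ ∈ Gal(E/F)` is `1` or `c` (`algEquiv_eq_one_or_eq`), `c * c = 1`, and the places of `E` above
  `v = w ∩ 𝓞_F` are `w` and `c⁻¹ • w` (`PlacesOver.eq_or_eq_galInv`, from the tree's transitivity
  `HeightOneSpectrum.exists_algEquiv_smul_eq`); `v` SPLITS at `w` iff `c • w ≠ w`, i.e. iff there are two of them;
* §2 the contragredient `g ↦ (g⁻¹)ᵀ` on `GL_n` of a commutative topological ring (`GLn.contragredient`, a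
  continuous involutive group automorphism) — generic;
* §3 **the split-place isomorphism** `UnitaryGroup.localPiSplitEquiv : localPi E c N J v ≃ₜ* GL (Fin N) (E_w)`
  for `w ∣ v` with `c • w ≠ w`, `J` hermitian (`(J.map c)ᵀ = J`) and invertible at `w`: the projection onto the
  `w`-component, with inverse `g ↦ (g, c⁻¹_* ((J g J⁻¹)⁻¹)ᵀ)` read off from `mem_localPi_iff`; composed with
  `localPiEquiv` this is `«local» E c N J v ≃ₜ* GL_N(E_w)` (`localSplitEquiv`);
* §4 integral points: `localPiSplitEquiv` maps `U(J)(𝒪_v)` (`localInt`) into `GL_N(𝒪_w)` (`glInt`), and ONTO it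
  when `J` and `J⁻¹` are `w`-integral (`localPiSplitEquiv_symm_mem_localInt_iff`, `localPiSplitEquiv_image_localInt`) — the hyperspecial case `v ∤ disc J`.

(`GL_N(E_w) ≅ GL_N(F_v)` itself — `[E_w : F_v] = e·f = 1` at a split `w` — is the tree's
`AdicCompletionDegreeOnePlaceProofs.exists_ringEquiv_adicCompletion_of_ramificationIdx_eq_one_of_inertiaDeg_eq_one`
and is not repeated here.)

## Mathlib / tree

Mathlib: `Algebra.IsQuadraticExtension` (+ `IsQuadraticExtension.isGalois`, `IsGalois.card_aut_eq_finrank`,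
`Nat.card_eq_two_iff'`), `Matrix.GeneralLinearGroup.map`, `Units.continuous_iff`; nothing of Mathlib is
duplicated (Mathlib has no unitary groups of hermitian forms over a quadratic extension, and no
`GL`-contragredient). Tree: `UnitaryGroupLocalFactors` (`localPi`, `mem_localPi_iff`, `localPiEquiv`,
`localInt`, `mem_localInt_iff`, `placeForm`, `PlacesOver.galInv`), `GaloisActionPlaces` (`galAdicCompletionMap`
and its cocycle / integrality lemmas, `exists_algEquiv_smul_eq`), `ReductiveGroupData` (`glInt`, `mem_glInt_iff`).

## Provenance

Written under the LEAN-IN-TREE rule (2026-08-18) for the pub-hodgecm formalisation cell (model-construction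
sub-cell, Mathlib-gap shims): the split-place structure of the local factors of that cell's adelic unitary
groups (CM case `F = L⁺`, `c` = complex conjugation). Nothing in this file is a claim of the manuscripts
adjudicated by that cell.

## References

* C. P. Mok, *Endoscopic classification of representations of quasi-split unitary groups*, Mem. AMS 235
  (2015), §1 Notation, p. 5 (`U_{E/F}(N)(F_v) ≅ GL_N(F_v)` for `v` split) [Mok2014].
* V. Platonov, A. Rapinchuk, *Algebraic Groups and Number Theory* (1994), §5.1 (the subgroups `G_{𝒪_v}`)
  [PlatonovRapinchuk1994].
* J. W. S. Cassels, A. Fröhlich (eds.), *Algebraic Number Theory* (1967), Ch. II §§10–11, Ch. VII §1.1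
  (places above `v`, Galois action on completions) [CasselsFrohlichANT1967].
-/

noncomputable section

open NumberField IsDedekindDomain Topology Filter
open scoped Matrix MatrixGroups

namespace Literature.NumberTheory.Automorphic

/-! ## 1. Quadratic extensions: `Gal(E/F) = {1, c}` and the places above `v` -/

section Quadratic

variable (F : Type*) [Field F] {E : Type*} [Field E] [Algebra F E]

/-- In a quadratic extension `E/F` (char. 0 is not needed: separable suffices, automatic for number fields via
`Algebra.IsSeparable` of char zero) with a non-trivial `F`-automorphism `c`, every `F`-automorphism is `1` or
`c`: `Gal(E/F) = {1, c}` (`|Gal| = [E:F] = 2`). [folklore] -/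
theorem algEquiv_eq_one_or_eq [Algebra.IsQuadraticExtension F E] [Algebra.IsSeparable F E]
    {c : E ≃ₐ[F] E} (hc : c ≠ 1) (σ : E ≃ₐ[F] E) : σ = 1 ∨ σ = c := by
  have h2 : Nat.card (E ≃ₐ[F] E) = 2 :=
    (Algebra.IsQuadraticExtension.finrank_eq_two F E) ▸ IsGalois.card_aut_eq_finrank F E
  rw [Nat.card_eq_two_iff' 1] at h2
  by_cases hσ : σ = 1
  · exact Or.inl hσ
  · exact Or.inr (h2.unique hσ hc)

/-- A non-trivial automorphism of a quadratic extension is an involution: `c * c = 1`. [folklore] -/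
theorem algEquiv_mul_self_eq_one [Algebra.IsQuadraticExtension F E] [Algebra.IsSeparable F E]
    {c : E ≃ₐ[F] E} (hc : c ≠ 1) : c * c = 1 := by
  rcases algEquiv_eq_one_or_eq F hc (c * c) with h | h
  · exact h
  · exact absurd (mul_left_cancel (a := c) (h.trans (mul_one c).symm)) hc

/-- … hence `c⁻¹ = c`. [folklore] -/
theorem algEquiv_inv_eq_self [Algebra.IsQuadraticExtension F E] [Algebra.IsSeparable F E]
    {c : E ≃ₐ[F] E} (hc : c ≠ 1) : c⁻¹ = c :=
  inv_eq_of_mul_eq_one_right (algEquiv_mul_self_eq_one F hc)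

end Quadratic

namespace UnitaryGroup

variable (F E : Type) [Field F] [NumberField F] [Field E] [NumberField E] [Algebra F E]
variable (c : E ≃ₐ[F] E) (N : ℕ) (J : Matrix (Fin N) (Fin N) E)

variable {F E} in
/-- Over a quadratic extension with `c ≠ 1`, **the places of `E` above `v = w ∩ 𝓞_F` are `w` and `c⁻¹ • w`**
(transitivity of `Gal(E/F) = {1, c}` on the fibre, tree `HeightOneSpectrum.exists_algEquiv_smul_eq`;
Cassels–Fröhlich VII Prop. 1.2 (ii)). [cite: CasselsFrohlichANT1967, Ch. VII Prop. 1.2 (ii)] -/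
theorem PlacesOver.eq_or_eq_galInv [Algebra.IsQuadraticExtension F E] (hc : c ≠ 1)
    {v : HeightOneSpectrum (𝓞 F)} (w w' : PlacesOver E v) : w' = w ∨ w' = PlacesOver.galInv c w := by
  obtain ⟨σ, hσ⟩ := HeightOneSpectrum.exists_algEquiv_smul_eq F (E := E) (w := w.1) (w' := w'.1)
    (w.2.trans w'.2.symm)
  rcases algEquiv_eq_one_or_eq F hc σ with rfl | rfl
  · left
    exact Subtype.ext ((one_smul _ w.1).symm.trans hσ).symm
  · right
    apply Subtype.ext
    change w'.1 = σ⁻¹ • w.1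
    rw [algEquiv_inv_eq_self F hc]
    exact hσ.symm

variable {F E} in
/-- `c⁻¹ • (c⁻¹ • w) = w`: `galInv c (galInv c w) = w`. [folklore] -/
theorem PlacesOver.galInv_galInv [Algebra.IsQuadraticExtension F E] (hc : c ≠ 1)
    {v : HeightOneSpectrum (𝓞 F)} (w : PlacesOver E v) : PlacesOver.galInv c (PlacesOver.galInv c w) = w := by
  apply Subtype.ext
  change c⁻¹ • c⁻¹ • w.1 = w.1
  rw [smul_smul, algEquiv_inv_eq_self F hc, algEquiv_mul_self_eq_one F hc, one_smul]

variable {F E} in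
/-- At a place where `c • w ≠ w` (a SPLIT place) the two places `w`, `c⁻¹ • w` above `v` are distinct.
[folklore] -/
theorem PlacesOver.galInv_ne {v : HeightOneSpectrum (𝓞 F)} (w : PlacesOver E v)
    (hw : c • w.1 ≠ w.1) : PlacesOver.galInv c w ≠ w := by
  intro h
  apply hw
  have h1 : c⁻¹ • w.1 = w.1 := congrArg Subtype.val h
  calc c • w.1 = c • c⁻¹ • w.1 := by rw [h1]
    _ = w.1 := smul_inv_smul c w.1

variable {F E} in
/-- At a split place the fibre above `v` has exactly two elements. [folklore] -/
theorem PlacesOver.card_eq_two [Algebra.IsQuadraticExtension F E] (hc : c ≠ 1)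
    {v : HeightOneSpectrum (𝓞 F)} (w : PlacesOver E v) (hw : c • w.1 ≠ w.1) :
    Nat.card (PlacesOver E v) = 2 := by
  rw [Nat.card_eq_two_iff' w]
  refine ⟨PlacesOver.galInv c w, PlacesOver.galInv_ne c w hw, fun w' hw' => ?_⟩
  exact (PlacesOver.eq_or_eq_galInv c hc w w').resolve_left hw'

end UnitaryGroup

/-! ## 2. The contragredient `g ↦ (g⁻¹)ᵀ` on `GL_n` -/

section Contragredient

variable {n : Type*} [Fintype n] [DecidableEq n] {R : Type*} [CommRing R]

/-- **The contragredient** `g ↦ (g⁻¹)ᵀ = (gᵀ)⁻¹`, a group endomorphism of `GL_n(R)` (`R` commutative).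
[folklore] -/
def GLn.contragredient : GL n R →* GL n R where
  toFun g :=
    { val := ((g⁻¹ : GL n R) : Matrix n n R)ᵀ
      inv := ((g : GL n R) : Matrix n n R)ᵀ
      val_inv := by rw [← Matrix.transpose_mul, Units.mul_inv, Matrix.transpose_one]
      inv_val := by rw [← Matrix.transpose_mul, Units.inv_mul, Matrix.transpose_one] }
  map_one' := Units.ext (by simp only [inv_one, Units.val_one, Matrix.transpose_one])
  map_mul' g h := Units.ext (by simp only [mul_inv_rev, Units.val_mul, Matrix.transpose_mul])

omit [Fintype n] [DecidableEq n] in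
/-- Entries: `contragredient g = (g⁻¹)ᵀ` as a matrix (definitional). [folklore] -/
@[simp] theorem GLn.coe_contragredient [Fintype n] [DecidableEq n] (g : GL n R) :
    ((GLn.contragredient g : GL n R) : Matrix n n R) = ((g⁻¹ : GL n R) : Matrix n n R)ᵀ := rfl

/-- The inverse of `contragredient g` is `gᵀ`. [folklore] -/
@[simp] theorem GLn.coe_contragredient_inv (g : GL n R) :
    (((GLn.contragredient g)⁻¹ : GL n R) : Matrix n n R) = ((g : GL n R) : Matrix n n R)ᵀ := rfl

/-- The contragredient is an involution. [folklore] -/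
@[simp] theorem GLn.contragredient_contragredient (g : GL n R) :
    GLn.contragredient (GLn.contragredient g) = g :=
  Units.ext (by rw [GLn.coe_contragredient, GLn.coe_contragredient_inv, Matrix.transpose_transpose])

/-- `(contragredient g)ᵀ = g⁻¹` on underlying matrices. [folklore] -/
@[simp] theorem GLn.coe_contragredient_transpose (g : GL n R) :
    ((GLn.contragredient g : GL n R) : Matrix n n R)ᵀ = ((g⁻¹ : GL n R) : Matrix n n R) := by
  rw [GLn.coe_contragredient, Matrix.transpose_transpose]

/-- The unit with underlying matrix `gᵀ` is `(contragredient g)⁻¹`: a matrix identity `gᵀ · X = Y` can be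
read in `GL_n`. [folklore] -/
theorem GLn.transpose_eq_coe_contragredient_inv (g : GL n R) :
    ((g : GL n R) : Matrix n n R)ᵀ = (((GLn.contragredient g)⁻¹ : GL n R) : Matrix n n R) := rfl

/-- The contragredient is continuous (for a topological ring `R`). [folklore] -/
theorem GLn.continuous_contragredient [TopologicalSpace R] [IsTopologicalRing R] :
    Continuous (GLn.contragredient : GL n R → GL n R) := by
  refine Units.continuous_iff.2 ⟨?_, ?_⟩
  · exact Units.continuous_coe_inv.matrix_transpose
  · exact Units.continuous_val.matrix_transpose

/-- Ring homomorphisms commute with the contragredient. [folklore] -/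
theorem GLn.map_contragredient {S : Type*} [CommRing S] (f : R →+* S) (g : GL n R) :
    Matrix.GeneralLinearGroup.map f (GLn.contragredient g) =
      GLn.contragredient (Matrix.GeneralLinearGroup.map f g) := by
  have h : (Matrix.GeneralLinearGroup.map f g)⁻¹ = Matrix.GeneralLinearGroup.map f g⁻¹ := (map_inv _ g).symm
  refine Units.ext ?_
  rw [GLn.coe_contragredient, h]
  ext i j
  simp only [Matrix.GeneralLinearGroup.map_apply, GLn.coe_contragredient, Matrix.transpose_apply]

end Contragredient

/-! ## 3. The split-place isomorphism `U(J)(F_v) ≃ GL_N(E_w)` -/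

namespace UnitaryGroup

variable {F E : Type} [Field F] [NumberField F] [Field E] [NumberField E] [Algebra F E]
variable (c : E ≃ₐ[F] E) {N : ℕ} (J : Matrix (Fin N) (Fin N) E)

/-! ### 3a. `GL_N(𝒪_w)`, the contragredient and Galois transport on `GL_N(E_w)` -/

/-- Membership in `𝒪[E_w]` (the valuation ring of the `ValuativeRel` structure keying `glInt`) is membership in
Mathlib's `w.adicCompletionIntegers E` (both are `|x|_w ≤ 1`); private copy of the lemma of
`GLnFiniteAdeleRestrictedProduct`. [folklore] -/
private theorem mem_integer_iff_mem_adicCompletionIntegers (w : HeightOneSpectrum (𝓞 E))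
    {x : w.adicCompletion E} :
    x ∈ (ValuativeRel.valuation (w.adicCompletion E)).integer ↔ x ∈ w.adicCompletionIntegers E := by
  rw [Valuation.mem_integer_iff, HeightOneSpectrum.mem_adicCompletionIntegers]
  exact (ValuativeRel.isEquiv (ValuativeRel.valuation (w.adicCompletion E))
    (Valued.v : Valuation (w.adicCompletion E) _)).le_one_iff_le_one

/-- `GL_N(𝒪_w)` in terms of `adicCompletionIntegers`: all entries of `g` and `g⁻¹` are `w`-integral. [folklore] -/
theorem mem_glInt_adicCompletion_iff (w : HeightOneSpectrum (𝓞 E)) (g : GL (Fin N) (w.adicCompletion E)) :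
    g ∈ glInt N (w.adicCompletion E) ↔
      (∀ i j, (g : Matrix (Fin N) (Fin N) (w.adicCompletion E)) i j ∈ w.adicCompletionIntegers E) ∧
        ∀ i j, ((g⁻¹ : GL (Fin N) (w.adicCompletion E)) : Matrix (Fin N) (Fin N) (w.adicCompletion E)) i j ∈
          w.adicCompletionIntegers E := by
  rw [mem_glInt_iff]
  simp only [mem_integer_iff_mem_adicCompletionIntegers]

/-- `GL_N(𝒪_w)` is stable under the contragredient. [folklore] -/
theorem contragredient_mem_glInt (w : HeightOneSpectrum (𝓞 E)) {g : GL (Fin N) (w.adicCompletion E)}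
    (hg : g ∈ glInt N (w.adicCompletion E)) : GLn.contragredient g ∈ glInt N (w.adicCompletion E) := by
  rw [mem_glInt_adicCompletion_iff] at hg ⊢
  refine ⟨fun i j => ?_, fun i j => ?_⟩
  · rw [GLn.coe_contragredient, Matrix.transpose_apply]; exact hg.2 j i
  · rw [GLn.coe_contragredient_inv, Matrix.transpose_apply]; exact hg.1 j i

omit [NumberField F] in
/-- Galois transport `σ_* : GL_N(E_w) → GL_N(E_{σ w})` preserves integral points. [folklore] -/
theorem map_galAdicCompletionMap_mem_glInt_iff (σ : E ≃ₐ[F] E) {w w' : HeightOneSpectrum (𝓞 E)}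
    (h : σ • w = w') (g : GL (Fin N) (w.adicCompletion E)) :
    Matrix.GeneralLinearGroup.map (galAdicCompletionMap σ h) g ∈ glInt N (w'.adicCompletion E) ↔
      g ∈ glInt N (w.adicCompletion E) := by
  rw [mem_glInt_adicCompletion_iff, mem_glInt_adicCompletion_iff, ← map_inv]
  simp only [Matrix.GeneralLinearGroup.map_apply, galAdicCompletionMap_mem_adicCompletionIntegers_iff]

omit [NumberField F] in
/-- `σ_*` on `GL_N` does not depend on the way `σ` and the proof are written. [folklore] -/
theorem map_galAdicCompletionMap_congr_left {σ₁ σ₂ : E ≃ₐ[F] E} (hσ : σ₁ = σ₂) {w w' : HeightOneSpectrum (𝓞 E)}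
    (h₁ : σ₁ • w = w') (h₂ : σ₂ • w = w') (g : GL (Fin N) (w.adicCompletion E)) :
    Matrix.GeneralLinearGroup.map (galAdicCompletionMap σ₁ h₁) g =
      Matrix.GeneralLinearGroup.map (galAdicCompletionMap σ₂ h₂) g := by
  subst hσ; rfl

omit [NumberField F] in
/-- `1_* = id` on `GL_N(E_w)`. [folklore] -/
theorem map_galAdicCompletionMap_one {w : HeightOneSpectrum (𝓞 E)} (h : (1 : E ≃ₐ[F] E) • w = w)
    (g : GL (Fin N) (w.adicCompletion E)) :
    Matrix.GeneralLinearGroup.map (galAdicCompletionMap (1 : E ≃ₐ[F] E) h) g = g := by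
  refine Units.ext (Matrix.ext fun i j => ?_)
  rw [Matrix.GeneralLinearGroup.map_apply, galAdicCompletionMap_one]

omit [NumberField F] in
/-- `σ_* (σ⁻¹_* g) = g` on `GL_N`. [folklore] -/
theorem map_galAdicCompletionMap_apply_inv (σ : E ≃ₐ[F] E) {w w' : HeightOneSpectrum (𝓞 E)}
    (h : σ • w = w') (h' : σ⁻¹ • w' = w) (g : GL (Fin N) (w'.adicCompletion E)) :
    Matrix.GeneralLinearGroup.map (galAdicCompletionMap σ h)
        (Matrix.GeneralLinearGroup.map (galAdicCompletionMap σ⁻¹ h') g) = g := by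
  refine Units.ext (Matrix.ext fun i j => ?_)
  rw [Matrix.GeneralLinearGroup.map_apply, Matrix.GeneralLinearGroup.map_apply, galAdicCompletionMap_apply_inv]

omit [NumberField F] in
/-- `σ⁻¹_* (σ_* g) = g` on `GL_N`. [folklore] -/
theorem map_galAdicCompletionMap_inv_apply (σ : E ≃ₐ[F] E) {w w' : HeightOneSpectrum (𝓞 E)}
    (h : σ • w = w') (h' : σ⁻¹ • w' = w) (g : GL (Fin N) (w.adicCompletion E)) :
    Matrix.GeneralLinearGroup.map (galAdicCompletionMap σ⁻¹ h')
        (Matrix.GeneralLinearGroup.map (galAdicCompletionMap σ h) g) = g := by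
  refine Units.ext (Matrix.ext fun i j => ?_)
  rw [Matrix.GeneralLinearGroup.map_apply, Matrix.GeneralLinearGroup.map_apply, galAdicCompletionMap_inv_apply]

omit [NumberField F] in
/-- Transport along an equality of places over `v`, for a family `u ∈ Π_{w ∣ v} GL_N(E_w)`. [folklore] -/
theorem map_galAdicCompletionMap_congr_place {v : HeightOneSpectrum (𝓞 F)} {σ : E ≃ₐ[F] E}
    {w₁ w₂ : PlacesOver E v} (hw : w₁ = w₂) {w' : HeightOneSpectrum (𝓞 E)} (h₁ : σ • w₁.1 = w')
    (h₂ : σ • w₂.1 = w') (u : LocalGLPi E N v) :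
    Matrix.GeneralLinearGroup.map (galAdicCompletionMap σ h₁) (u w₁) =
      Matrix.GeneralLinearGroup.map (galAdicCompletionMap σ h₂) (u w₂) := by
  subst hw; rfl

/-! ### 3b. The components of the inverse map -/

variable {v : HeightOneSpectrum (𝓞 F)}

open scoped Classical in
/-- For `w, w' ∣ v`: the element of `{1, c⁻¹} ⊆ Gal(E/F)` meant to carry `w` to `w'` (`1` if `w' = w`, else
`c⁻¹`; it does carry `w` to `w'` when `E/F` is quadratic and `c ≠ 1`, `splitGal_smul`). [folklore] -/
def splitGal (w w' : PlacesOver E v) : E ≃ₐ[F] E :=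
  if w'.1 = w.1 then 1 else c⁻¹

omit [NumberField F] [NumberField E] in
/-- `splitGal c w w' = 1` when `w' = w`. [folklore] -/
theorem splitGal_of_eq {w w' : PlacesOver E v} (h : w'.1 = w.1) : splitGal c w w' = 1 := by
  unfold splitGal; rw [if_pos h]

omit [NumberField F] [NumberField E] in
/-- `splitGal c w w' = c⁻¹` when `w' ≠ w`. [folklore] -/
theorem splitGal_of_ne {w w' : PlacesOver E v} (h : w'.1 ≠ w.1) : splitGal c w w' = c⁻¹ := by
  unfold splitGal; rw [if_neg h]

/-- In a quadratic `E/F` with `c ≠ 1`, `splitGal c w w'` carries `w` to `w'` (the fibre is `{w, c⁻¹ w}`).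
[folklore] -/
theorem splitGal_smul [Algebra.IsQuadraticExtension F E] (hc : c ≠ 1) (w w' : PlacesOver E v) :
    splitGal c w w' • w.1 = w'.1 := by
  unfold splitGal
  split_ifs with h
  · rw [one_smul, h]
  · rcases PlacesOver.eq_or_eq_galInv c hc w w' with rfl | rfl
    · exact absurd rfl h
    · rfl

/-- `g ↦ ((J_w g J_w⁻¹)⁻¹)ᵀ` on `GL_N(E_w)`: solve `ĝᵀ · J_w · g = J_w` for `ĝ` (the `c_*`-transport of the
second component of a point of `U(J)(F_v)` with first component `g`). [folklore] -/
def splitHat (w : PlacesOver E v) (Jw : GL (Fin N) (w.1.adicCompletion E)) :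
    GL (Fin N) (w.1.adicCompletion E) →* GL (Fin N) (w.1.adicCompletion E) :=
  GLn.contragredient.comp (MulAut.conj Jw).toMonoidHom

omit [NumberField F] in
/-- `splitHat w Jw g = ((Jw g Jw⁻¹)⁻¹)ᵀ` (definitional). [folklore] -/
theorem splitHat_apply (w : PlacesOver E v) (Jw g : GL (Fin N) (w.1.adicCompletion E)) :
    splitHat w Jw g = GLn.contragredient (Jw * g * Jw⁻¹) := rfl

omit [NumberField F] in
/-- The defining identity of `splitHat`: `ĝᵀ · J_w · g = J_w`. [folklore] -/
theorem splitHat_transpose_mul (w : PlacesOver E v) (Jw g : GL (Fin N) (w.1.adicCompletion E)) :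
    ((splitHat w Jw g : GL (Fin N) (w.1.adicCompletion E)) : Matrix (Fin N) (Fin N) (w.1.adicCompletion E))ᵀ *
        (Jw : Matrix (Fin N) (Fin N) (w.1.adicCompletion E)) * g = Jw := by
  rw [splitHat_apply, GLn.coe_contragredient_transpose, ← Units.val_mul, ← Units.val_mul]
  congr 1
  group

omit [NumberField F] in
/-- `splitHat` is continuous. [folklore] -/
theorem continuous_splitHat (w : PlacesOver E v) (Jw : GL (Fin N) (w.1.adicCompletion E)) :
    Continuous (splitHat w Jw) :=
  GLn.continuous_contragredient.comp ((continuous_const.mul continuous_id).mul continuous_const)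

section Split

variable [Algebra.IsQuadraticExtension F E]

open scoped Classical in
/-- The `w'`-component `GL_N(E_w) →* GL_N(E_{w'})` of the inverse of the projection `U(J)(F_v) → GL_N(E_w)`:
the identity (transported along `1`) for `w' = w`, and `g ↦ c⁻¹_* ((J_w g J_w⁻¹)⁻¹)ᵀ` for `w' = c⁻¹ w`.
[folklore] -/
def splitInvComponent (hc : c ≠ 1) (w : PlacesOver E v) (Jw : GL (Fin N) (w.1.adicCompletion E))
    (w' : PlacesOver E v) : GL (Fin N) (w.1.adicCompletion E) →* GL (Fin N) (w'.1.adicCompletion E) :=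
  (Matrix.GeneralLinearGroup.map (galAdicCompletionMap (splitGal c w w') (splitGal_smul c hc w w'))).comp
    (if w'.1 = w.1 then MonoidHom.id _ else splitHat w Jw)

/-- **The inverse of the projection** `U(J)(F_v) → GL_N(E_w)`, as a homomorphism
`GL_N(E_w) →* Π_{w' ∣ v} GL_N(E_{w'})`. [folklore] -/
def splitInv (hc : c ≠ 1) (w : PlacesOver E v) (Jw : GL (Fin N) (w.1.adicCompletion E)) :
    GL (Fin N) (w.1.adicCompletion E) →* LocalGLPi E N v :=
  MonoidHom.pi (splitInvComponent c hc w Jw)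

open scoped Classical in
/-- The `w`-component of `splitInv … g` is `g`. [folklore] -/
@[simp] theorem splitInv_apply_self (hc : c ≠ 1) (w : PlacesOver E v) (Jw g : GL (Fin N) (w.1.adicCompletion E)) :
    splitInv c hc w Jw g w = g := by
  change Matrix.GeneralLinearGroup.map _ ((if w.1 = w.1 then MonoidHom.id _ else splitHat w Jw) g) = g
  rw [if_pos rfl, MonoidHom.id_apply,
    map_galAdicCompletionMap_congr_left (splitGal_of_eq c rfl) _ (one_smul _ w.1), map_galAdicCompletionMap_one]

open scoped Classical in
/-- The `c⁻¹ w`-component of `splitInv … g` is `c⁻¹_* ((J_w g J_w⁻¹)⁻¹)ᵀ` (at a split place `c w ≠ w`).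
[folklore] -/
theorem splitInv_apply_galInv (hc : c ≠ 1) (w : PlacesOver E v) (hw : c • w.1 ≠ w.1)
    (Jw g : GL (Fin N) (w.1.adicCompletion E)) :
    splitInv c hc w Jw g (PlacesOver.galInv c w) =
      Matrix.GeneralLinearGroup.map (galAdicCompletionMap c⁻¹ rfl) (splitHat w Jw g) := by
  have hne : (PlacesOver.galInv c w).1 ≠ w.1 := fun h => PlacesOver.galInv_ne c w hw (Subtype.ext h)
  change Matrix.GeneralLinearGroup.map _
    ((if (PlacesOver.galInv c w).1 = w.1 then MonoidHom.id _ else splitHat w Jw) g) = _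
  rw [if_neg hne, map_galAdicCompletionMap_congr_left (splitGal_of_ne c hne)]

open scoped Classical in
/-- `splitInv` is continuous. [folklore] -/
theorem continuous_splitInv (hc : c ≠ 1) (w : PlacesOver E v) (Jw : GL (Fin N) (w.1.adicCompletion E)) :
    Continuous (splitInv c hc w Jw) := by
  refine continuous_pi fun w' => ?_
  change Continuous fun g => Matrix.GeneralLinearGroup.map
    (galAdicCompletionMap (splitGal c w w') (splitGal_smul c hc w w'))
    ((if w'.1 = w.1 then MonoidHom.id _ else splitHat w Jw) g)
  refine (Units.continuous_map ?_).comp ?_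
  · exact continuous_id.matrix_map (continuous_galAdicCompletionMap E _ _)
  · split_ifs
    · exact continuous_id
    · exact continuous_splitHat w Jw

/-! ### 3c. One equation suffices at a split place -/

/-- **Hermitian forms at conjugate places**: for `J` hermitian (`(c J)ᵀ = J`) and `c` an involution,
`J ∈ M_N(E_{c⁻¹ w})` is the transpose of the `c⁻¹`-transport of `J ∈ M_N(E_w)`. [folklore] -/
theorem placeForm_inv_smul (hc : c ≠ 1) (hJ : (J.map c)ᵀ = J) (w : HeightOneSpectrum (𝓞 E)) :
    placeForm J (c⁻¹ • w) = ((placeForm J w).map (galAdicCompletionMap c⁻¹ rfl))ᵀ := by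
  refine Matrix.ext fun i j => ?_
  have hij : c⁻¹ (J j i) = J i j := by
    rw [algEquiv_inv_eq_self F hc]
    have h := congrFun (congrFun hJ i) j
    simpa only [Matrix.transpose_apply, Matrix.map_apply] using h
  simp only [placeForm, Matrix.map_apply, Matrix.transpose_apply,
    IsDedekindDomain.HeightOneSpectrum.algebraMap_adicCompletion, Function.comp_apply, Algebra.algebraMap_self,
    RingHom.id_apply, galAdicCompletionMap_coe_algEquiv, hij]

/-- **At a split place one equation suffices.** For `J` hermitian, `c ≠ 1` and `w ∣ v`:
`u ∈ U(J)(F_v)` iff the single identity `(c_* u_{c⁻¹ w})ᵀ · J_w · u_w = J_w` holds in `M_N(E_w)` (the identity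
at the other place `c⁻¹ w` is its `c⁻¹`-transport, transposed). [folklore] -/
theorem mem_localPi_iff_of_split (hc : c ≠ 1) (hJ : (J.map c)ᵀ = J) (w : PlacesOver E v)
    (u : LocalGLPi E N v) :
    u ∈ localPi E c N J v ↔
      (((u (PlacesOver.galInv c w) : GL (Fin N) ((PlacesOver.galInv c w).1.adicCompletion E)) :
            Matrix (Fin N) (Fin N) ((PlacesOver.galInv c w).1.adicCompletion E)).map
          (galAdicCompletionMap c (smul_inv_smul c w.1)))ᵀ * placeForm J w.1 *
        ((u w : GL (Fin N) (w.1.adicCompletion E)) : Matrix (Fin N) (Fin N) (w.1.adicCompletion E)) =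
        placeForm J w.1 := by
  rw [mem_localPi_iff]
  refine ⟨fun h => h w, fun h w'' => ?_⟩
  rcases PlacesOver.eq_or_eq_galInv c hc w w'' with rfl | rfl
  · exact h
  · -- the identity at `c⁻¹ w` is the transposed `c⁻¹`-transport of the identity at `w`
    have hww : PlacesOver.galInv c (PlacesOver.galInv c w) = w := PlacesOver.galInv_galInv c hc w
    -- (1) `c⁻¹_* ∘ c_* = id` on matrices over `E_{c⁻¹ w}`
    have h2 : ∀ M : Matrix (Fin N) (Fin N) ((PlacesOver.galInv c w).1.adicCompletion E),
        (M.map (galAdicCompletionMap c (smul_inv_smul c w.1))).map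
          (galAdicCompletionMap c⁻¹ (rfl : c⁻¹ • w.1 = (PlacesOver.galInv c w).1)) = M := fun M =>
      Matrix.ext fun i j => galAdicCompletionMap_inv_apply E c (smul_inv_smul c w.1) rfl (M i j)
    -- (2) transport the `w`-identity along `c⁻¹_* : E_w → E_{c⁻¹ w}` and transpose it
    have h1 : (((u w : GL (Fin N) (w.1.adicCompletion E)) : Matrix (Fin N) (Fin N) (w.1.adicCompletion E)).map
          (galAdicCompletionMap c⁻¹ (rfl : c⁻¹ • w.1 = (PlacesOver.galInv c w).1)))ᵀ *
        (placeForm J (PlacesOver.galInv c w).1 *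
          ((u (PlacesOver.galInv c w) : GL (Fin N) ((PlacesOver.galInv c w).1.adicCompletion E)) :
            Matrix (Fin N) (Fin N) ((PlacesOver.galInv c w).1.adicCompletion E))) =
        placeForm J (PlacesOver.galInv c w).1 := by
      have h1' := congrArg (fun M : Matrix (Fin N) (Fin N) (w.1.adicCompletion E) =>
        (M.map (galAdicCompletionMap c⁻¹ (rfl : c⁻¹ • w.1 = (PlacesOver.galInv c w).1)))ᵀ) h
      simp only [Matrix.map_mul, Matrix.transpose_mul, Matrix.transpose_map, Matrix.transpose_transpose, h2] at h1'
      rwa [← placeForm_inv_smul c J hc hJ w.1] at h1'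
    -- (3) `c_* u_{c⁻¹ c⁻¹ w} = c⁻¹_* u_w` (`c⁻¹ c⁻¹ w = w`, `c = c⁻¹`)
    have h3 : ((u (PlacesOver.galInv c (PlacesOver.galInv c w)) :
          GL (Fin N) ((PlacesOver.galInv c (PlacesOver.galInv c w)).1.adicCompletion E)) :
            Matrix (Fin N) (Fin N) ((PlacesOver.galInv c (PlacesOver.galInv c w)).1.adicCompletion E)).map
        (galAdicCompletionMap c (smul_inv_smul c (PlacesOver.galInv c w).1)) =
        ((u w : GL (Fin N) (w.1.adicCompletion E)) : Matrix (Fin N) (Fin N) (w.1.adicCompletion E)).map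
          (galAdicCompletionMap c⁻¹ (rfl : c⁻¹ • w.1 = (PlacesOver.galInv c w).1)) := by
      have hcw : c • w.1 = (PlacesOver.galInv c w).1 := by
        change c • w.1 = c⁻¹ • w.1; rw [algEquiv_inv_eq_self F hc]
      exact congrArg (fun g : GL (Fin N) ((PlacesOver.galInv c w).1.adicCompletion E) =>
          (g : Matrix (Fin N) (Fin N) ((PlacesOver.galInv c w).1.adicCompletion E)))
        ((map_galAdicCompletionMap_congr_place hww (smul_inv_smul c (PlacesOver.galInv c w).1) hcw u).trans
          (map_galAdicCompletionMap_congr_left (algEquiv_inv_eq_self F hc).symm hcw rfl (u w)))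
    rw [h3, Matrix.mul_assoc]
    exact h1

/-! ### 3d. The isomorphism -/

/-- `splitInv … g ∈ U(J)(F_v)` when `Jw = J_w` (hermitian `J`, split place). [folklore] -/
theorem splitInv_mem (hc : c ≠ 1) (hJ : (J.map c)ᵀ = J) (w : PlacesOver E v) (hw : c • w.1 ≠ w.1)
    {Jw : GL (Fin N) (w.1.adicCompletion E)}
    (hJw : (Jw : Matrix (Fin N) (Fin N) (w.1.adicCompletion E)) = placeForm J w.1)
    (g : GL (Fin N) (w.1.adicCompletion E)) : splitInv c hc w Jw g ∈ localPi E c N J v := by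
  rw [mem_localPi_iff_of_split c J hc hJ w, splitInv_apply_self, splitInv_apply_galInv c hc w hw]
  have : ((Matrix.GeneralLinearGroup.map
        (galAdicCompletionMap c⁻¹ (rfl : c⁻¹ • w.1 = (PlacesOver.galInv c w).1)) (splitHat w Jw g) :
          GL (Fin N) ((PlacesOver.galInv c w).1.adicCompletion E)) :
          Matrix (Fin N) (Fin N) ((PlacesOver.galInv c w).1.adicCompletion E)).map
        (galAdicCompletionMap c (smul_inv_smul c w.1)) =
      ((splitHat w Jw g : GL (Fin N) (w.1.adicCompletion E)) : Matrix (Fin N) (Fin N) (w.1.adicCompletion E)) :=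
    congrArg (fun g : GL (Fin N) (w.1.adicCompletion E) => (g : Matrix (Fin N) (Fin N) (w.1.adicCompletion E)))
      (map_galAdicCompletionMap_apply_inv c (smul_inv_smul c w.1) rfl (splitHat w Jw g))
  rw [this, ← hJw, splitHat_transpose_mul]

/-- A point of `U(J)(F_v)` is determined by its `w`-component: `u = splitInv (u_w)`. [folklore] -/
theorem eq_splitInv_of_mem (hc : c ≠ 1) (hJ : (J.map c)ᵀ = J) (w : PlacesOver E v) (hw : c • w.1 ≠ w.1)
    {Jw : GL (Fin N) (w.1.adicCompletion E)}
    (hJw : (Jw : Matrix (Fin N) (Fin N) (w.1.adicCompletion E)) = placeForm J w.1)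
    {u : LocalGLPi E N v} (hu : u ∈ localPi E c N J v) : u = splitInv c hc w Jw (u w) := by
  rw [mem_localPi_iff_of_split c J hc hJ w] at hu
  funext w''
  rcases PlacesOver.eq_or_eq_galInv c hc w w'' with rfl | rfl
  · rw [splitInv_apply_self]
  · rw [splitInv_apply_galInv c hc w hw]
    -- read the `w`-identity in `GL_N(E_w)`: `y := c_* u_{c⁻¹ w}` satisfies `yᵀ J_w u_w = J_w`
    set y : GL (Fin N) (w.1.adicCompletion E) :=
      Matrix.GeneralLinearGroup.map (galAdicCompletionMap c (smul_inv_smul c w.1)) (u (PlacesOver.galInv c w))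
      with hy
    have h1 : (GLn.contragredient y)⁻¹ * Jw * u w = Jw := by
      refine Units.ext ?_
      rw [Units.val_mul, Units.val_mul, ← GLn.transpose_eq_coe_contragredient_inv, hJw]
      exact hu
    have h2 : GLn.contragredient y = Jw * u w * Jw⁻¹ := by
      have h1' : (GLn.contragredient y)⁻¹ = Jw * (u w)⁻¹ * Jw⁻¹ := by
        calc (GLn.contragredient y)⁻¹ = (GLn.contragredient y)⁻¹ * Jw * u w * ((u w)⁻¹ * Jw⁻¹) := by group
          _ = Jw * ((u w)⁻¹ * Jw⁻¹) := by rw [h1]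
          _ = Jw * (u w)⁻¹ * Jw⁻¹ := by group
      rw [← inv_inv (GLn.contragredient y), h1']
      group
    have h3 : y = splitHat w Jw (u w) := by
      rw [splitHat_apply, ← h2, GLn.contragredient_contragredient]
    rw [← h3, hy, map_galAdicCompletionMap_inv_apply]

omit [Algebra.IsQuadraticExtension F E] in
/-- `J` invertible in `M_N(E)` is invertible at every place. [folklore] -/
theorem isUnit_placeForm (hJu : IsUnit J) (w : HeightOneSpectrum (𝓞 E)) : IsUnit (placeForm J w) :=
  hJu.map (RingHom.mapMatrix (algebraMap E (w.adicCompletion E)))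

/-- **The local unitary group at a split place is `GL_N(E_w)`.** For `E/F` quadratic, `c ≠ 1`, `J` hermitian
and invertible at `w`, and `w ∣ v` with `c w ≠ w` (i.e. `v` splits in `E`, the places above it being `w ≠ c w`):
the projection `u ↦ u_w` is an isomorphism of topological groups `U(J)(F_v) ≃ₜ* GL_N(E_w)`, with inverse
`g ↦ (g, c⁻¹_* ((J g J⁻¹)⁻¹)ᵀ)`. (Mok §1: for `v` split `U(N)(F_v) ≅ GL_N(E_w) = GL_N(F_v)`; the
identification `E_w = F_v` is the tree's degree-one place isomorphism.) [folklore] -/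
def localPiSplitEquiv (hc : c ≠ 1) (hJ : (J.map c)ᵀ = J) (w : PlacesOver E v) (hw : c • w.1 ≠ w.1)
    (hJw : IsUnit (placeForm J w.1)) :
    localPi E c N J v ≃ₜ* GL (Fin N) (w.1.adicCompletion E) where
  toFun u := (u : LocalGLPi E N v) w
  invFun g := ⟨splitInv c hc w hJw.unit g, splitInv_mem c J hc hJ w hw hJw.unit_spec g⟩
  left_inv u := Subtype.ext (eq_splitInv_of_mem c J hc hJ w hw hJw.unit_spec u.2).symm
  right_inv g := splitInv_apply_self c hc w hJw.unit g
  map_mul' _ _ := rfl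
  continuous_toFun := (continuous_apply w).comp continuous_subtype_val
  continuous_invFun := (continuous_splitInv c hc w hJw.unit).subtype_mk _

/-- `localPiSplitEquiv u = u_w`. [folklore] -/
@[simp] theorem localPiSplitEquiv_apply (hc : c ≠ 1) (hJ : (J.map c)ᵀ = J) (w : PlacesOver E v)
    (hw : c • w.1 ≠ w.1) (hJw : IsUnit (placeForm J w.1)) (u : localPi E c N J v) :
    localPiSplitEquiv c J hc hJ w hw hJw u = (u : LocalGLPi E N v) w := rfl

/-- `(localPiSplitEquiv.symm g : Π_{w'} GL_N(E_{w'})) = splitInv g`. [folklore] -/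
@[simp] theorem coe_localPiSplitEquiv_symm_apply (hc : c ≠ 1) (hJ : (J.map c)ᵀ = J) (w : PlacesOver E v)
    (hw : c • w.1 ≠ w.1) (hJw : IsUnit (placeForm J w.1)) (g : GL (Fin N) (w.1.adicCompletion E)) :
    (((localPiSplitEquiv c J hc hJ w hw hJw).symm g : localPi E c N J v) : LocalGLPi E N v) =
      splitInv c hc w hJw.unit g := rfl

/-- **`U(J)(F_v) ≃ₜ* GL_N(E_w)`** in the matrix form `«local» E c N J v ≤ GL_N(E ⊗_F F_v)` of
`UnitaryGroupAutomorphicRep` (through `localPiEquiv`). [folklore] -/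
def localSplitEquiv (hc : c ≠ 1) (hJ : (J.map c)ᵀ = J) (w : PlacesOver E v) (hw : c • w.1 ≠ w.1)
    (hJw : IsUnit (placeForm J w.1)) : «local» E c N J v ≃ₜ* GL (Fin N) (w.1.adicCompletion E) :=
  (localPiEquiv E c N J v).symm.trans (localPiSplitEquiv c J hc hJ w hw hJw)

/-! ## 4. Integral points at a split place -/

/-- The projection maps `U(J)(𝒪_v)` into `GL_N(𝒪_w)`. [folklore] -/
theorem localPiSplitEquiv_mem_glInt (hc : c ≠ 1) (hJ : (J.map c)ᵀ = J) (w : PlacesOver E v)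
    (hw : c • w.1 ≠ w.1) (hJw : IsUnit (placeForm J w.1)) {u : localPi E c N J v}
    (hu : u ∈ localInt E c N J v) : localPiSplitEquiv c J hc hJ w hw hJw u ∈ glInt N (w.1.adicCompletion E) :=
  (mem_localInt_iff E c N J v u).1 hu w

/-- **`U(J)(𝒪_v) = GL_N(𝒪_w)` at a split place of good reduction**: if moreover `J_w ∈ GL_N(𝒪_w)` (`J` and
`J⁻¹` integral at `w`), the projection identifies the integral points `U(J)(𝒪_v)` with `GL_N(𝒪_w)`
(Platonov–Rapinchuk §5.1: `G_{𝒪_v}` for almost all `v`). [cite: PlatonovRapinchuk1994, §5.1] -/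
theorem localPiSplitEquiv_symm_mem_localInt_iff (hc : c ≠ 1) (hJ : (J.map c)ᵀ = J) (w : PlacesOver E v)
    (hw : c • w.1 ≠ w.1) (hJw : IsUnit (placeForm J w.1))
    (hJi : hJw.unit ∈ glInt N (w.1.adicCompletion E)) (g : GL (Fin N) (w.1.adicCompletion E)) :
    (localPiSplitEquiv c J hc hJ w hw hJw).symm g ∈ localInt E c N J v ↔ g ∈ glInt N (w.1.adicCompletion E) := by
  rw [mem_localInt_iff, coe_localPiSplitEquiv_symm_apply]
  refine ⟨fun h => ?_, fun hg w'' => ?_⟩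
  · simpa only [splitInv_apply_self] using h w
  · rcases PlacesOver.eq_or_eq_galInv c hc w w'' with rfl | rfl
    · rwa [splitInv_apply_self]
    · rw [splitInv_apply_galInv c hc _ hw, map_galAdicCompletionMap_mem_glInt_iff, splitHat_apply]
      exact contragredient_mem_glInt _ (Subgroup.mul_mem _ (Subgroup.mul_mem _ hJi hg) (Subgroup.inv_mem _ hJi))

/-- Hence `localPiSplitEquiv` restricts to a bijection `U(J)(𝒪_v) ≃ GL_N(𝒪_w)` (as an equality of images).
[folklore] -/
theorem localPiSplitEquiv_image_localInt (hc : c ≠ 1) (hJ : (J.map c)ᵀ = J) (w : PlacesOver E v)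
    (hw : c • w.1 ≠ w.1) (hJw : IsUnit (placeForm J w.1)) (hJi : hJw.unit ∈ glInt N (w.1.adicCompletion E)) :
    (localPiSplitEquiv c J hc hJ w hw hJw) '' (localInt E c N J v : Set (localPi E c N J v)) =
      (glInt N (w.1.adicCompletion E) : Set (GL (Fin N) (w.1.adicCompletion E))) := by
  ext g
  constructor
  · rintro ⟨u, hu, rfl⟩
    exact localPiSplitEquiv_mem_glInt c J hc hJ w hw hJw hu
  · intro hg
    exact ⟨(localPiSplitEquiv c J hc hJ w hw hJw).symm g,
      (localPiSplitEquiv_symm_mem_localInt_iff c J hc hJ w hw hJw hJi g).2 hg,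
      (localPiSplitEquiv c J hc hJ w hw hJw).apply_symm_apply g⟩

end Split

end UnitaryGroup

end Literature.NumberTheory.Automorphic

end
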